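import Summits.BirchSwinnertonDyer.BirchSwinnertonDyer.Theses.TameQuarticManinParity
import Literature.NumberTheory.EllipticCurves.ModularJacobianNeronDifferentialsTameProofs
import HarnessLib

/-!
# Route `TameQuarticManinParity`, LINE 38/41 (bsd-idea-3 g11), support N38b `ManinValuationJumpFormula`
# (stmt-BirchSwinnertonDyer-24042) — PROVED BY NAME over the landed carrier `TameNeronFormsAt` (p692978)

Cell `pub/bsd-wall`, D-0145 line `route-BirchSwinnertonDyer-TeichmullerTwistDescent`, seat `bsd-line-ttd-p1` g15,
working the planner-of-record's TQMP LINE 38/41. BSD is NOT proved by this; Manin's conjecture is not proved by this;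
the crux COL(III) (`TprimeIIIColengthBound`, stmt-24044) stays OPEN. This file closes ONLY the typed formula (B).

## Statement (verbatim the route decl)

For `Λ : TameNeronFormsAt N 3 8`, a globally minimal `W`, a lattice-optimal datum `D` of `W` at level `N` and
an exponent `a` with `HasTameGoodModel 3 8 W a`:
`Λ.tameColength D a + Λ.jdeg (Λ.f_mem D) = a + 8 * padicValInt 3 D.maninConstant`.

## Proof

Literally the typer's theorem `TameNeronFormsAt.tameColength_add_jdeg_eq_of_hasTameGoodModel`
(`ModularJacobianNeronDifferentialsTameProofs`, p694736/p695294) at `(p, e) = (3, 8)`. Design: theorems only; no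
definition, no named fact, no `sorry`; axioms `propext`, `Classical.choice`, `Quot.sound`.
-/

set_option autoImplicit false
-- D-0017: single-problem summit, so `Summit.BirchSwinnertonDyer.BirchSwinnertonDyer.…` repeats a namespace BY DESIGN.
set_option linter.dupNamespace false

namespace Summit.BirchSwinnertonDyer.BirchSwinnertonDyer.Theorems.TameQuarticManinParity

open Summit.BirchSwinnertonDyer.BirchSwinnertonDyer.Theses.TameQuarticManinParity
open Literature.NumberTheory.EllipticCurves.ModularForms

/-- **N38b, the Manin valuation jump formula** (stmt-BirchSwinnertonDyer-24042), by name: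
`col_K + jdeg = a + 8·v₃(c)` for a lattice-optimal datum of a globally minimal curve acquiring good reduction over
`ℚ(ϖ)`, `ϖ⁸ = −3`, with Néron exponent `a` — the typer's `tameColength_add_jdeg_eq_of_hasTameGoodModel` at
`(p, e) = (3, 8)`. [cite: EdixhovenManin1991, §4 (the formula for v_p(c))] -/
theorem maninValuationJumpFormula_proof : ManinValuationJumpFormula := by
  unfold ManinValuationJumpFormula
  intro N _ Λ W _ _ D hL a ha
  exact Λ.tameColength_add_jdeg_eq_of_hasTameGoodModel Nat.prime_three (by norm_num) D hL ha

end Summit.BirchSwinnertonDyer.BirchSwinnertonDyer.Theorems.TameQuarticManinParity
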